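import Mathlib
import HarnessLib
import Literature.MathematicalPhysics.QuantumLattice.KohnLuttinger
import Summits.HubbardSuperconductivity.HubbardSuperconductivity.Theorems.WeakCouplingBCSWcbcsKohnLuttingerB1gReduction
import Summits.HubbardSuperconductivity.HubbardSuperconductivity.Theorems.WeakCouplingBCSKlCertTPrimeD4Invariant

/-!
# Route `WeakCouplingBCS` — the Fermi-curve measure is finite from a SPEED FLOOR and a FINITE LENGTH (generic band)
# (located input S3 of «(KLSCAN)-TPRIME-SOUNDNESS», hypothesis style; certificate half of stmt-HubbardSuperconductivity-0158; seat p4 g19)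

The registered leaf `stub_klFiniteMeasure` (…ChiralWindowCwKLChiralWindowFiniteMeasure) is specific to `squareDispersion 1 0` on
`μ ∈ (-4, 0)`, where the speed floor `‖∇ε₀‖² ≥ -μ(4+μ)` is algebraic.  For the `t`–`t′` band (or any band) the same two inputs give the
same conclusion; here they are HYPOTHESES, to be discharged per scan cell — the speed floor `v_min > 0` on the Fermi curve by the certified
`χ₀`/`v_F` engine of the KL-MARGIN-SCAN (margin-1), the finite arc length by the analytic leaf «HausdorffFinite-tp»:

* `klph_fermiCurveMeasure_univ_le` — `σ[ε, μ](univ) ≤ v⁻¹ · μH[1](F)` whenever `v ≤ ‖∇ε‖` on `F = fermiCurve ε μ`, `v > 0`;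
* `klph_isFiniteMeasure_of_speedFloor` — hence `IsFiniteMeasure (fermiCurveMeasure ε μ)` if moreover `μH[1] F < ∞`.

Generic in a measurable band `ε`; no definitions; nothing asserts a margin, a window or superconductivity.
References: S. Raghu, S. A. Kivelson, D. J. Scalapino, Phys. Rev. B 81 (2010) 224505, §II (6), (8).
-/

noncomputable section

-- the tree's namespace `Summit.<Summit>.<Problem>.Theorems` repeats the summit name by design (D-0017)
set_option linter.dupNamespace false

namespace Summit.HubbardSuperconductivity.HubbardSuperconductivity.Theorems

open MeasureTheory Set Real Literature.MathematicalPhysics.QuantumLattice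
open scoped ENNReal

/-- **Total mass of the Fermi-curve measure under a speed floor**: if `0 < v ≤ ‖∇ε k‖` for every `k` on the Fermi curve `F`, then
`σ[ε, μ](univ) ≤ v⁻¹ · μH[1](F)` (the density `‖∇ε‖⁻¹` is at most `v⁻¹` on `F`). [cite: RaghuKivelsonScalapino2010, §II (6)] -/
theorem klph_fermiCurveMeasure_univ_le {ε : Momentum → ℝ} (hε : Measurable ε) (μ : ℝ) {v : ℝ} (hv : 0 < v)
    (hspeed : ∀ k ∈ fermiCurve ε μ, v ≤ ‖gradient ε k‖) :
    fermiCurveMeasure ε μ univ ≤ ENNReal.ofReal v⁻¹ * μH[1] (fermiCurve ε μ) := by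
  have hF : MeasurableSet (fermiCurve ε μ) := measurableSet_fermiCurve hε μ
  unfold fermiCurveMeasure
  rw [withDensity_apply _ MeasurableSet.univ, Measure.restrict_univ]
  calc ∫⁻ k in fermiCurve ε μ, ENNReal.ofReal (‖gradient ε k‖⁻¹) ∂(μH[1] : Measure Momentum)
      ≤ ∫⁻ _ in fermiCurve ε μ, ENNReal.ofReal v⁻¹ ∂(μH[1] : Measure Momentum) := by
        refine lintegral_mono_ae ?_
        filter_upwards [ae_restrict_mem hF] with k hk
        exact ENNReal.ofReal_le_ofReal (inv_anti₀ hv (hspeed k hk))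
    _ = ENNReal.ofReal v⁻¹ * μH[1] (fermiCurve ε μ) := by
        rw [lintegral_const, Measure.restrict_apply MeasurableSet.univ, univ_inter]

/-- **The Fermi-curve measure is finite from a speed floor and a finite length** (generic band; hypothesis-style twin of
`stub_klFiniteMeasure`). [cite: RaghuKivelsonScalapino2010, §II (6)] -/
theorem klph_isFiniteMeasure_of_speedFloor {ε : Momentum → ℝ} (hε : Measurable ε) (μ : ℝ) {v : ℝ} (hv : 0 < v)
    (hspeed : ∀ k ∈ fermiCurve ε μ, v ≤ ‖gradient ε k‖) (hlen : μH[1] (fermiCurve ε μ) < ⊤) :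
    IsFiniteMeasure (fermiCurveMeasure ε μ) := by
  refine ⟨lt_of_le_of_lt (klph_fermiCurveMeasure_univ_le hε μ hv hspeed) ?_⟩
  exact ENNReal.mul_lt_top ENNReal.ofReal_lt_top hlen

/-- The squared Fermi speed of the `t`–`t′` band, explicitly:
`‖∇ε_{t′}(k)‖² = (2 sin k₀ (1 + 2t′cos k₁))² + (2 sin k₁ (1 + 2t′cos k₀))²` — the quantity an interval engine certifies. [folklore] -/
theorem klph_speed_sq (tp : ℝ) (k : Momentum) :
    ‖gradient (squareDispersion 1 tp) k‖ ^ 2 =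
      (2 * sin (k 0) * (1 + 2 * tp * cos (k 1))) ^ 2 + (2 * sin (k 1) * (1 + 2 * tp * cos (k 0))) ^ 2 := by
  rw [klph_gradient_squareDispersion, kl_d4_norm_mk, Real.sq_sqrt (by positivity)]

/-- The same for the `t`–`t′` band, with the speed floor stated on the explicit squared Fermi speed (`klph_speed_sq`): a certified
`w > 0` with `w ≤ (2 sin k₀ (1 + 2t′cos k₁))² + (2 sin k₁ (1 + 2t′cos k₀))²` on the Fermi curve and a finite length give a finite measure.
[cite: RaghuKivelsonScalapino2010, §II (6)] -/
theorem klph_isFiniteMeasure_tp_of_speedSqFloor (tp μ : ℝ) {w : ℝ} (hw : 0 < w)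
    (hspeed : ∀ k ∈ fermiCurve (squareDispersion 1 tp) μ,
      w ≤ (2 * sin (k 0) * (1 + 2 * tp * cos (k 1))) ^ 2 + (2 * sin (k 1) * (1 + 2 * tp * cos (k 0))) ^ 2)
    (hlen : μH[1] (fermiCurve (squareDispersion 1 tp) μ) < ⊤) :
    IsFiniteMeasure (fermiCurveMeasure (squareDispersion 1 tp) μ) := by
  refine klph_isFiniteMeasure_of_speedFloor (measurable_squareDispersion 1 tp) μ (Real.sqrt_pos.2 hw) (fun k hk => ?_) hlen
  rw [← Real.sqrt_sq (norm_nonneg (gradient (squareDispersion 1 tp) k)), klph_speed_sq tp k]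
  exact Real.sqrt_le_sqrt (hspeed k hk)

end Summit.HubbardSuperconductivity.HubbardSuperconductivity.Theorems

end
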